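import Summits.QuantumFields.BalabanUV.T4Continuum.Support.NE3LinearisedAverageSup
import Summits.QuantumFields.BalabanUV.T4Continuum.Support.NE3QuadRemainderTower
import HarnessLib

/-!
# T⁴ programme, node NE3, route Π item Π-C (file Π-C-3a) — LEVEL BOOKKEEPING OF A K-TOWER: the level-`i` background of a
# `(L^K·N)`-periodic small-field `W` (unitarity, radius, period `L^{K−i}·N`, curvature line), the sup letter of the PARTIAL linear towers
# `dirIter L m (cavgIter L i W)`, `i + m ≤ K`, and the one-step remainder `E_i` at level `i` (size, skewness, period)

NE3 formalisation swarm `b2b-balaban-t4-ne3-formalise-*`, LEAF PROVER 02 (gen 7); route Π item Π-C (owner's D-ne3p1-g24-1 §6; SHAPE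
`HOME/t4/b2b-balaban-t4-ne3-formalise-leaf-02/g7/PI-C-SHAPE-leaf02g7.md`; INTENT HOME/CLAIMS.log l.22318, owner GO l.22393).  Pure bookkeeping
over Π-C-1 (`NE3LinearisedAverageSup`) and Π-C-2 (`NE3QuadRemainderTower`) so that the k-free induction of Π-C-3b (`NE3QuadRemainderSup`) reads
level by level; no new estimate.

CONTENT (all [folklore]; 0 sorry; 0 def): §0 `radIter_shift`, `curvSum_shift_le`, `pow_tower_eq`; §1 **`levelPkg`** (level `i ≤ K` of the tower:
`IsUnitaryCfg`, `0 ≤ r_i`, `SmallField`, period `L^{K−i}·N`, `512(d+1)(d+4)L²r_i ≤ 1`, `LevelSmall (m−1) r_i` and `curvSum m r_i ≤ (2∕3)L` for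
`i + m ≤ K`); §2 **`norm_dirIter_le_sup_at`** (`‖dirIter L m (cavgIter L i W) Y‖_∞ ≤ (3+12d)·L^m·t` for skew `(L^{K−i}N)`-periodic `Y`, `i + m ≤ K`);
§3 `relIter_periodic_at` (period `L^{K−i}N` of `relIter L i W X`), **`level_remainder`** (given a sup `t ≤ rho0∕4` of the skew level-`i` coordinate
`X_i = relIter L i W X`, `i < K`: the one-step remainder `E_i = relStep L W_i X_i − cpush L W_i X_i` has `‖E_i‖ ≤ 2(t∕rho0)²`, is skew and
`(L^{K−i−1}N)`-periodic, and `relStep L W_i X_i` is skew).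

HONEST FRAMING.  Bookkeeping on OUR frame; nothing about Bałaban's minimisers; the k-free remainder bound is Π-C-3b; `DecomposedRep`'s sizes,
T-E_w♯, NE3 NOT proved; spine PROVED 0∕9; finite T⁴ rung (B)+1 — NOT infinite volume, NOT mass gap, NOT BetaPertH, NOT Clay.  ABSOLUTE RULE kept
(context only: [Balaban1985Averaging] (42) p. 23, (127)–(135) pp. 37–38).  PLACEMENT: `Summits/QuantumFields/BalabanUV/`.  HONEST DEPENDENCY:
continuum YM on T⁴ ⇐ BetaPertH ∧ nine spine estimates (0/9 proved); BetaPertH ⇐ (D1) ∧ (D4) ∧ CAP+tail; G-an2-4 gates asym, D1 and NE2/3/4.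
-/

set_option autoImplicit false

open scoped BigOperators Matrix.Norms.L2Operator
open Finset

namespace Summit.QuantumFields.BalabanUV.T4Continuum.NE3QuadRemainderLevels

open Literature.MathematicalPhysics.QuantumFieldTheory.Balaban1983to89
open B7Prop1Explicit B7Prop2Explicit
open T4AveragingDeficitWall (IsUnitaryCfg IsSkewDir SmallField vary)
open T4AveragingDeficitWallBoundary (IsPeriodicCfg)
open AveragingDeficitPeriodicCounting (IsPeriodicDir)
open AveragingDeficitChartCalculus (cavg)
open AveragingDeficitTwoLevelPrep (twoLevelSmall prop1Radius)
open AveragingDeficitMultiLevelPrep (cpush cavgIter radIter tower LevelSmall isPeriodicDir_cpush isPeriodicCfg_cavgIter)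
open BlockAverageVaryDisc (rho0 rho0_pos)
open NE3TangentCovariantTower (dirIter dirIter_zero)
open NE3FramePotBoundW (tower_eq_pow_mul levelSmall_of_le)
open NE3LinearisedAverageSup (curv curvSum curv_nonneg radIter_nonneg curvSum_nonneg curvSum_mono levelSmall_shift levelData norm_dirIter_le_sup)
open NE3QuadRemainderTower (relStep relIter relIter_periodic norm_relStep_sub_cpush_le relStep_skew relStep_add_period cpush_skew)

noncomputable section

variable {d : ℕ} {n : Type*} [Fintype n] [DecidableEq n]

/-! ## §0 Radius and curvature bookkeeping -/

omit [Fintype n] [DecidableEq n] in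
/-- `radIter` is a flow: `radIter d L (m + i) x = radIter d L i (radIter d L m x)`. [folklore] -/
theorem radIter_shift (L : ℕ) : ∀ (m : ℕ) (i : ℕ) (x : ℝ), radIter d L (m + i) x = radIter d L i (radIter d L m x)
  | 0, i, x => by rw [Nat.zero_add]; rfl
  | m + 1, i, x => by
      rw [show m + 1 + i = (m + i) + 1 by omega]
      show radIter d L (m + i) (prop1Radius d L x) = radIter d L i (radIter d L m (prop1Radius d L x))
      exact radIter_shift L m i _

omit [Fintype n] [DecidableEq n] in
/-- The summed curvature letter of a partial tower is dominated by the full one: `curvSum d L m (radIter d L i x) ≤ curvSum d L (i + m) x` (`x ≥ 0`).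
[folklore] -/
theorem curvSum_shift_le (L : ℕ) (i m : ℕ) {x : ℝ} (hx : 0 ≤ x) : curvSum d L m (radIter d L i x) ≤ curvSum d L (i + m) x := by
  unfold curvSum
  rw [Finset.sum_range_add]
  have h1 : 0 ≤ ∑ l ∈ range i, curv d L (radIter d L l x) := Finset.sum_nonneg fun l _ => curv_nonneg L (radIter_nonneg L l hx)
  have h2 : ∑ l ∈ range m, curv d L (radIter d L l (radIter d L i x)) = ∑ l ∈ range m, curv d L (radIter d L (i + l) x) :=
    Finset.sum_congr rfl fun l _ => by rw [radIter_shift]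
  linarith [h2]

omit [Fintype n] [DecidableEq n] in
/-- Period bookkeeping: `tower L (L^(K−i−m)·N) m = L^(K−i)·N` for `i + m ≤ K`. [folklore] -/
theorem tower_partial_eq (L N : ℕ) {K i m : ℕ} (h : i + m ≤ K) : tower L (L ^ (K - i - m) * N) m = L ^ (K - i) * N := by
  rw [tower_eq_pow_mul, ← mul_assoc, ← pow_add, show m + (K - i - m) = K - i by omega]

/-! ## §1 The level package -/

/-- **THE LEVEL PACKAGE** of a `(L^K·N)`-periodic unitary `W` in the tower class (`0 ≤ x`, `LevelSmall d L K x` — one level of slack —, `SmallField W x`,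
curvature line `curvSum d L K x ≤ (2∕3)·L`) at level `i ≤ K`: the background `W_i := cavgIter L i W` is unitary of plaquette radius `r_i := radIter d L i x ≥ 0`,
`(L^{K−i}·N)`-periodic, with `512(d+1)(d+4)L²r_i ≤ 1`, and for every `m` with `i + m ≤ K`: `1 ≤ m → LevelSmall d L (m−1) r_i` and `curvSum d L m r_i ≤ (2∕3)L`.
[folklore] -/
theorem levelPkg [Nonempty n] {L N K : ℕ} (hL : 1 ≤ L) {W : Site d → Fin d → (Matrix n n ℂ)ˣ} {x : ℝ} (hWu : IsUnitaryCfg W)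
    (hWP : IsPeriodicCfg W ((L ^ K * N : ℕ) : ℤ)) (hx : 0 ≤ x) (hsm : LevelSmall d L K x) (hWx : SmallField W x)
    (hA : curvSum d L K x ≤ 2 / 3 * L) {i : ℕ} (hi : i ≤ K) :
    IsUnitaryCfg (cavgIter L i W) ∧ 0 ≤ radIter d L i x ∧ SmallField (cavgIter L i W) (radIter d L i x)
      ∧ IsPeriodicCfg (cavgIter L i W) ((L ^ (K - i) * N : ℕ) : ℤ)
      ∧ 512 * (d + 1) * (d + 4) * (L : ℝ) ^ 2 * radIter d L i x ≤ 1
      ∧ (∀ m : ℕ, i + m ≤ K → 1 ≤ m → LevelSmall d L (m - 1) (radIter d L i x))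
      ∧ (∀ m : ℕ, i + m ≤ K → curvSum d L m (radIter d L i x) ≤ 2 / 3 * L) := by
  obtain ⟨hU, hr, hS, hcls⟩ := levelData hL hWu hx hsm hWx (m := i) (by omega)
  refine ⟨hU, hr, hS, ?_, (hcls hi).2, fun m him hm => ?_, fun m him => (curvSum_shift_le L i m hx).trans ((curvSum_mono L him hx).trans hA)⟩
  · have hP : IsPeriodicCfg W ((tower L (L ^ (K - i) * N) i : ℕ) : ℤ) := by
      rw [tower_eq_pow_mul, ← mul_assoc, ← pow_add, Nat.add_sub_cancel' hi]; exact hWP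
    exact isPeriodicCfg_cavgIter L _ i hP
  · exact levelSmall_shift i (i := m - 1) (levelSmall_of_le (by omega) hsm)

/-! ## §2 The sup letter of the partial linear towers -/

/-- **THE SUP LETTER OF A PARTIAL LINEAR TOWER**: for `i + m ≤ K`, a skew `(L^{K−i}·N)`-periodic `Y` with `‖Y‖ ≤ t` (`t ≥ 0`):
`‖dirIter L m (cavgIter L i W) Y z κ‖ ≤ (3 + 12d)·L^m·t` (Π-C-1's `norm_dirIter_le_sup` at the level-`i` background; `m = 0` is the identity). [folklore] -/
theorem norm_dirIter_le_sup_at [Nonempty n] {L N K : ℕ} [NeZero N] (hL : 2 ≤ L) {W : Site d → Fin d → (Matrix n n ℂ)ˣ} {x : ℝ}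
    (hWu : IsUnitaryCfg W) (hWP : IsPeriodicCfg W ((L ^ K * N : ℕ) : ℤ)) (hx : 0 ≤ x) (hsm : LevelSmall d L K x) (hWx : SmallField W x)
    (hA : curvSum d L K x ≤ 2 / 3 * L) {i m : ℕ} (him : i + m ≤ K) {Y : Site d → Fin d → Matrix n n ℂ} (hYs : IsSkewDir Y)
    (hYP : IsPeriodicDir Y ((L ^ (K - i) * N : ℕ) : ℤ)) {t : ℝ} (ht : 0 ≤ t) (hY : ∀ (z : Site d) (μ : Fin d), ‖Y z μ‖ ≤ t)
    (z : Site d) (κ : Fin d) :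
    ‖dirIter L m (cavgIter L i W) Y z κ‖ ≤ (3 + 12 * (d : ℝ)) * (L : ℝ) ^ m * t := by
  have hL1 : 1 ≤ L := by omega
  rcases m with _ | m
  · rw [dirIter_zero, pow_zero, mul_one]
    have hd : (0 : ℝ) ≤ d := Nat.cast_nonneg d
    nlinarith [hY z κ]
  · obtain ⟨hU, hr, hS, hP, -, hls, hcv⟩ := levelPkg hL1 hWu hWP hx hsm hWx hA (i := i) (by omega)
    haveI : NeZero (L ^ (K - i - (m + 1)) * N) := ⟨Nat.mul_ne_zero (pow_ne_zero _ (by omega)) (NeZero.ne N)⟩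
    have hP' : IsPeriodicCfg (cavgIter L i W) ((tower L (L ^ (K - i - (m + 1)) * N) (m + 1) : ℕ) : ℤ) := by
      rw [tower_partial_eq L N him]; exact hP
    have hYP' : IsPeriodicDir Y ((tower L (L ^ (K - i - (m + 1)) * N) (m + 1) : ℕ) : ℤ) := by
      rw [tower_partial_eq L N him]; exact hYP
    have hsm' : LevelSmall d L m (radIter d L i x) := by
      have := hls (m + 1) him (by omega); rwa [Nat.add_sub_cancel] at this
    exact norm_dirIter_le_sup hL m hU hP' hr hsm' hS hYs hYP' ht hY (hcv (m + 1) him) z κ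

/-! ## §3 The level-`i` coordinate and its one-step remainder -/

/-- The level-`i` nonlinear coordinate `relIter L i W X` of `(L^K·N)`-periodic data is `(L^{K−i}·N)`-periodic (`i ≤ K`; no regime). [folklore] -/
theorem relIter_periodic_at (L : ℕ) {N K i : ℕ} (hi : i ≤ K) {W : Site d → Fin d → (Matrix n n ℂ)ˣ} {X : Site d → Fin d → Matrix n n ℂ}
    (hWP : IsPeriodicCfg W ((L ^ K * N : ℕ) : ℤ)) (hXP : IsPeriodicDir X ((L ^ K * N : ℕ) : ℤ)) :
    IsPeriodicDir (relIter L i W X) ((L ^ (K - i) * N : ℕ) : ℤ) := by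
  have e : L ^ i * (L ^ (K - i) * N) = L ^ K * N := by rw [← mul_assoc, ← pow_add, Nat.add_sub_cancel' hi]
  refine relIter_periodic L i (L ^ (K - i) * N) ?_ ?_
  · rw [e]; exact hWP
  · rw [e]; exact hXP

/-- **THE ONE-STEP REMAINDER AT LEVEL `i < K`**: given the level package and a skew `(L^{K−i}N)`-periodic level-`i` coordinate `X_i := relIter L i W X` with
`‖X_i‖ ≤ t`, `0 ≤ t ≤ rho0 d L ∕ 4`, the remainder `E_i := relStep L W_i X_i − cpush L W_i X_i` (`W_i = cavgIter L i W`) satisfies `‖E_i z κ‖ ≤ 2·(t∕rho0 d L)²`,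
is skew and `(L^{K−i−1}N)`-periodic; and `relStep L W_i X_i` is skew. [cite: Balaban1985Averaging, Prop. 3 (122)–(123) p.36] -/
theorem level_remainder [Nonempty n] {L N K : ℕ} (hL : 1 ≤ L) {W : Site d → Fin d → (Matrix n n ℂ)ˣ} {x : ℝ} (hWu : IsUnitaryCfg W)
    (hWP : IsPeriodicCfg W ((L ^ K * N : ℕ) : ℤ)) (hx : 0 ≤ x) (hsm : LevelSmall d L K x) (hWx : SmallField W x)
    (hA : curvSum d L K x ≤ 2 / 3 * L) {i : ℕ} (hi : i < K) {X : Site d → Fin d → Matrix n n ℂ}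
    (hXP : IsPeriodicDir X ((L ^ K * N : ℕ) : ℤ)) (hXis : IsSkewDir (relIter L i W X))
    {t : ℝ} (ht : 0 ≤ t) (hXit : ∀ (z : Site d) (μ : Fin d), ‖relIter L i W X z μ‖ ≤ t) (htr : t ≤ rho0 d L / 4) :
    (∀ (z : Site d) (κ : Fin d),
        ‖relStep L (cavgIter L i W) (relIter L i W X) z κ - cpush L (cavgIter L i W) (relIter L i W X) z κ‖ ≤ 2 * (t / rho0 d L) ^ 2)
      ∧ IsSkewDir (fun z κ => relStep L (cavgIter L i W) (relIter L i W X) z κ - cpush L (cavgIter L i W) (relIter L i W X) z κ)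
      ∧ IsPeriodicDir (fun z κ => relStep L (cavgIter L i W) (relIter L i W X) z κ - cpush L (cavgIter L i W) (relIter L i W X) z κ)
          ((L ^ (K - i - 1) * N : ℕ) : ℤ)
      ∧ IsSkewDir (relStep L (cavgIter L i W) (relIter L i W X)) := by
  obtain ⟨hU, hr, hS, hP, h512, -, -⟩ := levelPkg hL hWu hWP hx hsm hWx hA (i := i) hi.le
  have hrel : IsSkewDir (relStep L (cavgIter L i W) (relIter L i W X)) := relStep_skew hL hU hr h512 hS hXis hXit htr
  have hcp : IsSkewDir (cpush L (cavgIter L i W) (relIter L i W X)) := cpush_skew hL hU hr h512 hS hXis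
  have hXiP := relIter_periodic_at L hi.le hWP hXP
  -- period cast: `L^(K-i)·N = L·(L^(K-i-1)·N)`
  have e : ((L ^ (K - i) * N : ℕ) : ℤ) = (L : ℤ) * ((L ^ (K - i - 1) * N : ℕ) : ℤ) := by
    rw [show K - i = (K - i - 1) + 1 by omega, pow_succ]; push_cast; ring
  rw [e] at hP hXiP
  refine ⟨fun z κ => norm_relStep_sub_cpush_le hL hU hr h512 hS ht hXit htr z κ,
    fun z κ => (skewAdjoint (Matrix n n ℂ)).sub_mem (hrel z κ) (hcp z κ), fun z j κ => ?_, hrel⟩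
  have h1 := relStep_add_period L _ hP hXiP z j κ
  have h2 := isPeriodicDir_cpush L _ hP hXiP z j κ
  simp only [h1, h2]

end

end Summit.QuantumFields.BalabanUV.T4Continuum.NE3QuadRemainderLevels
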